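import Summits.CriticalPhenomena.PercolationContinuityZ3.Theorems.PercNearOneGluingNoHeavyLowerTailPivotalCellsRandomCluster
import Summits.CriticalPhenomena.PercolationContinuityZ3.Theorems.PercNearOneGluingNoHeavyLowerTailPivotalDualRowR4
import HarnessLib

/-!
# `NoHeavyLowerTail` (stmt-CriticalPhenomena-4575) — the dual rows dR2, dR3, dR4⁺ and the conditional positive correlation for the
# random-cluster measure `φ_{𝐩,q}`, EVERY `q ≥ 1`

Support file (prover prim-gen-kcluster gen 48; `--supports stmt-CriticalPhenomena-4575`).  No named facts, no sorries, no definitions.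
KCLUSTER-gen46 §3.3 recorded the T-side rows dR2–dR4⁺ as "FKG-regime rows: THEOREM for `q ≥ 1` GIVEN BHK-q at that `q`".  BHK-q for
`q ≥ 1` is now the kernel theorem `PivotalBHK.bhkRow_rcMeasureW` (split-vertex vdBHK Thm 1.4, this gen), so the chains of parts VI–VII
(`dualRowR3_real`, `dualRowR4_real`: two BHK rows × three Harris inequalities) run verbatim for `φ = rcMeasureW w q ∅`, `q ≥ 1`, with
FKG (`rcMeasureW_fkg`) in place of Harris (inputs: `dualRow_inputs_rcMeasureW`).  Results, literally the statements of
`dualRowR3_prodBernoulli` / `posCorr_prodBernoulli` / `dualRowR4_prodBernoulli` (part VIII) with `prodBernoulli w` replaced by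
`rcMeasureW w q ∅`, `1 ≤ q`:
* `dualRowR3_rcMeasureW` — dR3 `T_a · T_b ≤ u_c · T₀`;
* `posCorr_rcMeasureW` — given `{a ↔ b off c}`, the events `{a ↔ c off b}` and `{b ↔ c off a}` are positively correlated;
* `dualRowR4_rcMeasureW` — dR4⁺ `T_a · (u_a + T_c) ≤ u_b · (T₀ + T_b)`;
* `dualRowR2_rcMeasureW` — dR2 in atom form `u_a · T_a ≤ q · T₀` (Harris + BHK rows at `b` and `c`, as in part III).
[cite: VandenbergHaggstromKahn2005, Thm. 1.4 (p. 7); Grimmett2006, Thm. (3.8)]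
-/

noncomputable section

namespace Summit.CriticalPhenomena.PercolationContinuityZ3.Theorems

namespace PivotalBHK

open Literature.Probability.Percolation Literature.Probability.Percolation.BHK2006
open MeasureTheory Literature.Probability.LatticeModels SimpleGraph
open scoped Classical

section Rows

variable {V : Type*} [Fintype V]

/-- **dR3 for the random-cluster measure, every `q ≥ 1`** (the `φ_{𝐩,q}`-version of
`dualRowR3_prodBernoulli`): `T_a · T_b ≤ u_c · T₀`, i.e. conditionally on `{a ↔ b off c}` the events
`{a ↔ c off b}` and `{b ↔ c off a}` are positively correlated under `φ = rcMeasureW w q ∅`.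
PROOF: the degree-four chain `dualRowR3_real` of part VI fed with the BHK rows at `a` and at `b` for
`φ_{𝐩,q}` (`bhkRow_rcMeasureW`, this gen) and FKG for `φ_{𝐩,q}` (`rcMeasureW_fkg`) in place of Harris
(`dualRow_inputs_rcMeasureW`). [cite: VandenbergHaggstromKahn2005, Thm. 1.4 (p. 7); Grimmett2006, Thm. (3.8)] -/
theorem dualRowR3_rcMeasureW (w : Sym2 V → unitInterval) {q : ℝ} (hq : 1 ≤ q) {a b c : V}
    (hab : a ≠ b) (hac : a ≠ c) (hbc : b ≠ c) :
    (rcMeasureW w q ∅).real {ω : BondConfig V | {e | e ∈ ω ∧ a ∉ e} ∉ openConn b c ∧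
        {e | e ∈ ω ∧ b ∉ e} ∈ openConn a c ∧ {e | e ∈ ω ∧ c ∉ e} ∈ openConn a b} *
      (rcMeasureW w q ∅).real {ω : BondConfig V | {e | e ∈ ω ∧ a ∉ e} ∈ openConn b c ∧
        {e | e ∈ ω ∧ b ∉ e} ∉ openConn a c ∧ {e | e ∈ ω ∧ c ∉ e} ∈ openConn a b} ≤
    (rcMeasureW w q ∅).real {ω : BondConfig V | {e | e ∈ ω ∧ a ∉ e} ∉ openConn b c ∧
        {e | e ∈ ω ∧ b ∉ e} ∉ openConn a c ∧ {e | e ∈ ω ∧ c ∉ e} ∈ openConn a b} *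
      (rcMeasureW w q ∅).real {ω : BondConfig V | {e | e ∈ ω ∧ a ∉ e} ∈ openConn b c ∧
        {e | e ∈ ω ∧ b ∉ e} ∈ openConn a c ∧ {e | e ∈ ω ∧ c ∉ e} ∈ openConn a b} := by
  have hq0 : 0 < q := one_pos.trans_le hq
  haveI := isProbabilityMeasure_rcMeasureW w hq0 ∅
  obtain ⟨rowa, rowb, hH1, hH2, hH3, -, -, -⟩ := dualRow_inputs_rcMeasureW w hq hab hac hbc
  set μ := rcMeasureW w q ∅ with hμ
  set Ha : Set (BondConfig V) := {ω | {e | e ∈ ω ∧ a ∉ e} ∈ openConn b c} with hHa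
  set Hb : Set (BondConfig V) := {ω | {e | e ∈ ω ∧ b ∉ e} ∈ openConn a c} with hHb
  set Hc : Set (BondConfig V) := {ω | {e | e ∈ ω ∧ c ∉ e} ∈ openConn a b} with hHc
  -- additivity over the atoms
  have sAc : μ.real Haᶜ = μ.real (Haᶜ ∩ Hb ∩ Hc) + μ.real (Haᶜ ∩ Hb ∩ Hcᶜ) +
      (μ.real (Haᶜ ∩ Hbᶜ ∩ Hc) + μ.real (Haᶜ ∩ Hbᶜ ∩ Hcᶜ)) := by
    rw [KNGoodTwoMark.real_split μ Haᶜ Hb, KNGoodTwoMark.real_split μ (Haᶜ ∩ Hb) Hc, KNGoodTwoMark.real_split μ (Haᶜ ∩ Hbᶜ) Hc]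
  have sAB : μ.real (Ha ∩ Hb) = μ.real (Ha ∩ Hb ∩ Hc) + μ.real (Ha ∩ Hb ∩ Hcᶜ) :=
    KNGoodTwoMark.real_split μ (Ha ∩ Hb) Hc
  have sAcB : μ.real (Haᶜ ∩ Hb) = μ.real (Haᶜ ∩ Hb ∩ Hc) + μ.real (Haᶜ ∩ Hb ∩ Hcᶜ) :=
    KNGoodTwoMark.real_split μ (Haᶜ ∩ Hb) Hc
  have sABc : μ.real (Ha ∩ Hbᶜ) = μ.real (Ha ∩ Hbᶜ ∩ Hc) + μ.real (Ha ∩ Hbᶜ ∩ Hcᶜ) :=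
    KNGoodTwoMark.real_split μ (Ha ∩ Hbᶜ) Hc
  have sAcBc : μ.real (Haᶜ ∩ Hbᶜ) = μ.real (Haᶜ ∩ Hbᶜ ∩ Hc) + μ.real (Haᶜ ∩ Hbᶜ ∩ Hcᶜ) :=
    KNGoodTwoMark.real_split μ (Haᶜ ∩ Hbᶜ) Hc
  have sCAc : μ.real (Hc ∩ Haᶜ) = μ.real (Haᶜ ∩ Hb ∩ Hc) + μ.real (Haᶜ ∩ Hbᶜ ∩ Hc) := by
    rw [KNGoodTwoMark.real_split μ (Hc ∩ Haᶜ) Hb]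
    have e1 : Hc ∩ Haᶜ ∩ Hb = Haᶜ ∩ Hb ∩ Hc := by ext ω; simp only [Set.mem_inter_iff]; tauto
    have e2 : Hc ∩ Haᶜ ∩ Hbᶜ = Haᶜ ∩ Hbᶜ ∩ Hc := by ext ω; simp only [Set.mem_inter_iff]; tauto
    rw [e1, e2]
  rw [sAcB, sABc, sAB, sAcBc] at hH1
  rw [sCAc, sAc] at hH2
  rw [sAB] at hH3
  have key := dualRowR3_real (q := μ.real (Haᶜ ∩ Hbᶜ ∩ Hcᶜ)) (ua := μ.real (Ha ∩ Hbᶜ ∩ Hcᶜ))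
    (ub := μ.real (Haᶜ ∩ Hb ∩ Hcᶜ)) (uc := μ.real (Haᶜ ∩ Hbᶜ ∩ Hc)) (Ta := μ.real (Haᶜ ∩ Hb ∩ Hc))
    (Tb := μ.real (Ha ∩ Hbᶜ ∩ Hc)) (T0 := μ.real (Ha ∩ Hb ∩ Hc))
    (Z := μ.real (Ha ∩ Hb ∩ Hc) + μ.real (Ha ∩ Hb ∩ Hcᶜ)) (w := μ.real Hc)
    (nα := μ.real (Haᶜ ∩ Hbᶜ ∩ Hcᶜ) + μ.real (Ha ∩ Hbᶜ ∩ Hcᶜ) + μ.real (Haᶜ ∩ Hbᶜ ∩ Hc) +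
      μ.real (Ha ∩ Hbᶜ ∩ Hc))
    (nβ := μ.real (Haᶜ ∩ Hbᶜ ∩ Hcᶜ) + μ.real (Haᶜ ∩ Hb ∩ Hcᶜ) + μ.real (Haᶜ ∩ Hbᶜ ∩ Hc) +
      μ.real (Haᶜ ∩ Hb ∩ Hc))
    measureReal_nonneg measureReal_nonneg measureReal_nonneg measureReal_nonneg measureReal_nonneg
    measureReal_nonneg measureReal_nonneg (by positivity) rowa rowb rfl rfl
    (by linarith [hH1]) (by linarith [hH2]) hH3
  -- read the conclusion on the statement's events
  have e1 : {ω : BondConfig V | {e | e ∈ ω ∧ a ∉ e} ∉ openConn b c ∧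
      {e | e ∈ ω ∧ b ∉ e} ∈ openConn a c ∧ {e | e ∈ ω ∧ c ∉ e} ∈ openConn a b} = Haᶜ ∩ Hb ∩ Hc := by
    ext ω; simp only [Set.mem_inter_iff, Set.mem_compl_iff, hHa, hHb, hHc, Set.mem_setOf_eq]; tauto
  have e2 : {ω : BondConfig V | {e | e ∈ ω ∧ a ∉ e} ∈ openConn b c ∧
      {e | e ∈ ω ∧ b ∉ e} ∉ openConn a c ∧ {e | e ∈ ω ∧ c ∉ e} ∈ openConn a b} = Ha ∩ Hbᶜ ∩ Hc := by
    ext ω; simp only [Set.mem_inter_iff, Set.mem_compl_iff, hHa, hHb, hHc, Set.mem_setOf_eq]; tauto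
  have e3 : {ω : BondConfig V | {e | e ∈ ω ∧ a ∉ e} ∉ openConn b c ∧
      {e | e ∈ ω ∧ b ∉ e} ∉ openConn a c ∧ {e | e ∈ ω ∧ c ∉ e} ∈ openConn a b} = Haᶜ ∩ Hbᶜ ∩ Hc := by
    ext ω; simp only [Set.mem_inter_iff, Set.mem_compl_iff, hHa, hHb, hHc, Set.mem_setOf_eq]; tauto
  have e4 : {ω : BondConfig V | {e | e ∈ ω ∧ a ∉ e} ∈ openConn b c ∧
      {e | e ∈ ω ∧ b ∉ e} ∈ openConn a c ∧ {e | e ∈ ω ∧ c ∉ e} ∈ openConn a b} = Ha ∩ Hb ∩ Hc := by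
    ext ω; simp only [Set.mem_inter_iff, hHa, hHb, hHc, Set.mem_setOf_eq]; tauto
  rw [e1, e2, e3, e4]
  exact key

/-- **Positive correlation for the random-cluster measure, every `q ≥ 1`** (the `φ_{𝐩,q}`-version of
`posCorr_prodBernoulli`): `P(H_b H_c) · P(H_a H_c) ≤ P(H_c) · P(H_a H_b H_c)` — given `{a ↔ b off c}`,
the events `{a ↔ c off b}` and `{b ↔ c off a}` are positively correlated under `φ = rcMeasureW w q ∅`
(van den Berg–Häggström–Kahn prove the NEGATIVE correlation of two clusters given NON-connection;
this is the dual statement given connection).  Equivalent to dR3 (`dualRowR3_rcMeasureW`) by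
`(T₀ + T_a)(T₀ + T_b) ≤ (T₀ + T_a + T_b + u_c) T₀ ⟺ T_a T_b ≤ u_c T₀`.
[cite: VandenbergHaggstromKahn2005, Thm. 1.4 (p. 7); Grimmett2006, Thm. (3.8)] -/
theorem posCorr_rcMeasureW (w : Sym2 V → unitInterval) {q : ℝ} (hq : 1 ≤ q) {a b c : V}
    (hab : a ≠ b) (hac : a ≠ c) (hbc : b ≠ c) :
    (rcMeasureW w q ∅).real {ω : BondConfig V | {e | e ∈ ω ∧ b ∉ e} ∈ openConn a c ∧
        {e | e ∈ ω ∧ c ∉ e} ∈ openConn a b} *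
      (rcMeasureW w q ∅).real {ω : BondConfig V | {e | e ∈ ω ∧ a ∉ e} ∈ openConn b c ∧
        {e | e ∈ ω ∧ c ∉ e} ∈ openConn a b} ≤
    (rcMeasureW w q ∅).real {ω : BondConfig V | {e | e ∈ ω ∧ c ∉ e} ∈ openConn a b} *
      (rcMeasureW w q ∅).real {ω : BondConfig V | {e | e ∈ ω ∧ a ∉ e} ∈ openConn b c ∧
        {e | e ∈ ω ∧ b ∉ e} ∈ openConn a c ∧ {e | e ∈ ω ∧ c ∉ e} ∈ openConn a b} := by
  have hq0 : 0 < q := one_pos.trans_le hq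
  haveI := isProbabilityMeasure_rcMeasureW w hq0 ∅
  have d := dualRowR3_rcMeasureW w hq hab hac hbc
  set μ := rcMeasureW w q ∅ with hμ
  set Ha : Set (BondConfig V) := {ω | {e | e ∈ ω ∧ a ∉ e} ∈ openConn b c} with hHa
  set Hb : Set (BondConfig V) := {ω | {e | e ∈ ω ∧ b ∉ e} ∈ openConn a c} with hHb
  set Hc : Set (BondConfig V) := {ω | {e | e ∈ ω ∧ c ∉ e} ∈ openConn a b} with hHc
  have e1 : {ω : BondConfig V | {e | e ∈ ω ∧ a ∉ e} ∉ openConn b c ∧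
      {e | e ∈ ω ∧ b ∉ e} ∈ openConn a c ∧ {e | e ∈ ω ∧ c ∉ e} ∈ openConn a b} = Hb ∩ Hc ∩ Haᶜ := by
    ext ω; simp only [Set.mem_inter_iff, Set.mem_compl_iff, hHa, hHb, hHc, Set.mem_setOf_eq]; tauto
  have e2 : {ω : BondConfig V | {e | e ∈ ω ∧ a ∉ e} ∈ openConn b c ∧
      {e | e ∈ ω ∧ b ∉ e} ∉ openConn a c ∧ {e | e ∈ ω ∧ c ∉ e} ∈ openConn a b} = Ha ∩ Hc ∩ Hbᶜ := by
    ext ω; simp only [Set.mem_inter_iff, Set.mem_compl_iff, hHa, hHb, hHc, Set.mem_setOf_eq]; tauto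
  have e3 : {ω : BondConfig V | {e | e ∈ ω ∧ a ∉ e} ∉ openConn b c ∧
      {e | e ∈ ω ∧ b ∉ e} ∉ openConn a c ∧ {e | e ∈ ω ∧ c ∉ e} ∈ openConn a b} = Hc ∩ Haᶜ ∩ Hbᶜ := by
    ext ω; simp only [Set.mem_inter_iff, Set.mem_compl_iff, hHa, hHb, hHc, Set.mem_setOf_eq]; tauto
  have e4 : {ω : BondConfig V | {e | e ∈ ω ∧ a ∉ e} ∈ openConn b c ∧
      {e | e ∈ ω ∧ b ∉ e} ∈ openConn a c ∧ {e | e ∈ ω ∧ c ∉ e} ∈ openConn a b} = Hb ∩ Hc ∩ Ha := by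
    ext ω; simp only [Set.mem_inter_iff, hHa, hHb, hHc, Set.mem_setOf_eq]; tauto
  have e5 : {ω : BondConfig V | {e | e ∈ ω ∧ b ∉ e} ∈ openConn a c ∧
      {e | e ∈ ω ∧ c ∉ e} ∈ openConn a b} = Hb ∩ Hc := by
    ext ω; simp only [Set.mem_inter_iff, hHb, hHc, Set.mem_setOf_eq]
  have e6 : {ω : BondConfig V | {e | e ∈ ω ∧ a ∉ e} ∈ openConn b c ∧
      {e | e ∈ ω ∧ c ∉ e} ∈ openConn a b} = Ha ∩ Hc := by
    ext ω; simp only [Set.mem_inter_iff, hHa, hHc, Set.mem_setOf_eq]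
  rw [e1, e2, e3, e4] at d
  rw [e5, e6, e4]
  -- additivity
  have s1 := KNGoodTwoMark.real_split μ (Hb ∩ Hc) Ha
  have s2 := KNGoodTwoMark.real_split μ (Ha ∩ Hc) Hb
  have s3 : μ.real Hc = μ.real (Hb ∩ Hc ∩ Ha) + μ.real (Hb ∩ Hc ∩ Haᶜ) +
      (μ.real (Ha ∩ Hc ∩ Hbᶜ) + μ.real (Hc ∩ Haᶜ ∩ Hbᶜ)) := by
    rw [KNGoodTwoMark.real_split μ Hc Hb, KNGoodTwoMark.real_split μ (Hc ∩ Hb) Ha, KNGoodTwoMark.real_split μ (Hc ∩ Hbᶜ) Ha]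
    have f1 : Hc ∩ Hb ∩ Ha = Hb ∩ Hc ∩ Ha := by ext ω; simp only [Set.mem_inter_iff]; tauto
    have f2 : Hc ∩ Hb ∩ Haᶜ = Hb ∩ Hc ∩ Haᶜ := by ext ω; simp only [Set.mem_inter_iff]; tauto
    have f3 : Hc ∩ Hbᶜ ∩ Ha = Ha ∩ Hc ∩ Hbᶜ := by ext ω; simp only [Set.mem_inter_iff]; tauto
    have f4 : Hc ∩ Hbᶜ ∩ Haᶜ = Hc ∩ Haᶜ ∩ Hbᶜ := by ext ω; simp only [Set.mem_inter_iff]; tauto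
    rw [f1, f2, f3, f4]
  have f5 : Ha ∩ Hc ∩ Hb = Hb ∩ Hc ∩ Ha := by ext ω; simp only [Set.mem_inter_iff]; tauto
  rw [f5] at s2
  rw [s1, s2, s3]
  nlinarith [d, measureReal_nonneg (μ := μ) (s := Hb ∩ Hc ∩ Ha),
    measureReal_nonneg (μ := μ) (s := Hb ∩ Hc ∩ Haᶜ), measureReal_nonneg (μ := μ) (s := Ha ∩ Hc ∩ Hbᶜ),
    measureReal_nonneg (μ := μ) (s := Hc ∩ Haᶜ ∩ Hbᶜ)]

/-- **dR4⁺ for the random-cluster measure, every `q ≥ 1`** (the `φ_{𝐩,q}`-version of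
`dualRowR4_prodBernoulli`): `T_a · (u_a + T_c) ≤ u_b · (T₀ + T_b)` — the chain `dualRowR4_real` of
part VII fed with the BHK row at `a` for `φ_{𝐩,q}` and FKG (`dualRow_inputs_rcMeasureW`).
[cite: VandenbergHaggstromKahn2005, Thm. 1.4 (p. 7); Grimmett2006, Thm. (3.8)] -/
theorem dualRowR4_rcMeasureW (w : Sym2 V → unitInterval) {q : ℝ} (hq : 1 ≤ q) {a b c : V}
    (hab : a ≠ b) (hac : a ≠ c) (hbc : b ≠ c) :
    (rcMeasureW w q ∅).real {ω : BondConfig V | {e | e ∈ ω ∧ a ∉ e} ∉ openConn b c ∧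
        {e | e ∈ ω ∧ b ∉ e} ∈ openConn a c ∧ {e | e ∈ ω ∧ c ∉ e} ∈ openConn a b} *
      ((rcMeasureW w q ∅).real {ω : BondConfig V | {e | e ∈ ω ∧ a ∉ e} ∈ openConn b c ∧
          {e | e ∈ ω ∧ b ∉ e} ∉ openConn a c ∧ {e | e ∈ ω ∧ c ∉ e} ∉ openConn a b} +
        (rcMeasureW w q ∅).real {ω : BondConfig V | {e | e ∈ ω ∧ a ∉ e} ∈ openConn b c ∧
          {e | e ∈ ω ∧ b ∉ e} ∈ openConn a c ∧ {e | e ∈ ω ∧ c ∉ e} ∉ openConn a b}) ≤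
    (rcMeasureW w q ∅).real {ω : BondConfig V | {e | e ∈ ω ∧ a ∉ e} ∉ openConn b c ∧
        {e | e ∈ ω ∧ b ∉ e} ∈ openConn a c ∧ {e | e ∈ ω ∧ c ∉ e} ∉ openConn a b} *
      ((rcMeasureW w q ∅).real {ω : BondConfig V | {e | e ∈ ω ∧ a ∉ e} ∈ openConn b c ∧
          {e | e ∈ ω ∧ b ∉ e} ∈ openConn a c ∧ {e | e ∈ ω ∧ c ∉ e} ∈ openConn a b} +
        (rcMeasureW w q ∅).real {ω : BondConfig V | {e | e ∈ ω ∧ a ∉ e} ∈ openConn b c ∧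
          {e | e ∈ ω ∧ b ∉ e} ∉ openConn a c ∧ {e | e ∈ ω ∧ c ∉ e} ∈ openConn a b}) := by
  have hq0 : 0 < q := one_pos.trans_le hq
  haveI := isProbabilityMeasure_rcMeasureW w hq0 ∅
  obtain ⟨rowa, -, -, hH2, -, hH3, -, -⟩ := dualRow_inputs_rcMeasureW w hq hab hac hbc
  set μ := rcMeasureW w q ∅ with hμ
  set Ha : Set (BondConfig V) := {ω | {e | e ∈ ω ∧ a ∉ e} ∈ openConn b c} with hHa
  set Hb : Set (BondConfig V) := {ω | {e | e ∈ ω ∧ b ∉ e} ∈ openConn a c} with hHb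
  set Hc : Set (BondConfig V) := {ω | {e | e ∈ ω ∧ c ∉ e} ∈ openConn a b} with hHc
  -- additivity over the atoms
  have sA : μ.real Ha = μ.real (Ha ∩ Hb ∩ Hc) + μ.real (Ha ∩ Hb ∩ Hcᶜ) +
      (μ.real (Ha ∩ Hbᶜ ∩ Hc) + μ.real (Ha ∩ Hbᶜ ∩ Hcᶜ)) := by
    rw [KNGoodTwoMark.real_split μ Ha Hb, KNGoodTwoMark.real_split μ (Ha ∩ Hb) Hc, KNGoodTwoMark.real_split μ (Ha ∩ Hbᶜ) Hc]
  have sAc : μ.real Haᶜ = μ.real (Haᶜ ∩ Hb ∩ Hc) + μ.real (Haᶜ ∩ Hb ∩ Hcᶜ) +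
      (μ.real (Haᶜ ∩ Hbᶜ ∩ Hc) + μ.real (Haᶜ ∩ Hbᶜ ∩ Hcᶜ)) := by
    rw [KNGoodTwoMark.real_split μ Haᶜ Hb, KNGoodTwoMark.real_split μ (Haᶜ ∩ Hb) Hc, KNGoodTwoMark.real_split μ (Haᶜ ∩ Hbᶜ) Hc]
  have sAC : μ.real (Ha ∩ Hc) = μ.real (Ha ∩ Hb ∩ Hc) + μ.real (Ha ∩ Hbᶜ ∩ Hc) := by
    rw [KNGoodTwoMark.real_split μ (Ha ∩ Hc) Hb]
    have e1 : Ha ∩ Hc ∩ Hb = Ha ∩ Hb ∩ Hc := by ext ω; simp only [Set.mem_inter_iff]; tauto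
    have e2 : Ha ∩ Hc ∩ Hbᶜ = Ha ∩ Hbᶜ ∩ Hc := by ext ω; simp only [Set.mem_inter_iff]; tauto
    rw [e1, e2]
  have sCAc : μ.real (Hc ∩ Haᶜ) = μ.real (Haᶜ ∩ Hb ∩ Hc) + μ.real (Haᶜ ∩ Hbᶜ ∩ Hc) := by
    rw [KNGoodTwoMark.real_split μ (Hc ∩ Haᶜ) Hb]
    have e1 : Hc ∩ Haᶜ ∩ Hb = Haᶜ ∩ Hb ∩ Hc := by ext ω; simp only [Set.mem_inter_iff]; tauto
    have e2 : Hc ∩ Haᶜ ∩ Hbᶜ = Haᶜ ∩ Hbᶜ ∩ Hc := by ext ω; simp only [Set.mem_inter_iff]; tauto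
    rw [e1, e2]
  rw [sCAc, sAc] at hH2
  rw [sA, sAC] at hH3
  have key := dualRowR4_real (q := μ.real (Haᶜ ∩ Hbᶜ ∩ Hcᶜ)) (ua := μ.real (Ha ∩ Hbᶜ ∩ Hcᶜ))
    (ub := μ.real (Haᶜ ∩ Hb ∩ Hcᶜ)) (uc := μ.real (Haᶜ ∩ Hbᶜ ∩ Hc)) (Ta := μ.real (Haᶜ ∩ Hb ∩ Hc))
    (Tb := μ.real (Ha ∩ Hbᶜ ∩ Hc)) (Tc := μ.real (Ha ∩ Hb ∩ Hcᶜ)) (T0 := μ.real (Ha ∩ Hb ∩ Hc))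
    (w := μ.real Hc)
    (nβ := μ.real (Haᶜ ∩ Hbᶜ ∩ Hcᶜ) + μ.real (Haᶜ ∩ Hb ∩ Hcᶜ) + μ.real (Haᶜ ∩ Hbᶜ ∩ Hc) +
      μ.real (Haᶜ ∩ Hb ∩ Hc))
    (Pβ := μ.real (Ha ∩ Hbᶜ ∩ Hcᶜ) + μ.real (Ha ∩ Hbᶜ ∩ Hc) + μ.real (Ha ∩ Hb ∩ Hcᶜ) +
      μ.real (Ha ∩ Hb ∩ Hc))
    measureReal_nonneg measureReal_nonneg measureReal_nonneg measureReal_nonneg measureReal_nonneg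
    measureReal_nonneg measureReal_nonneg measureReal_nonneg rowa rfl rfl
    (by linarith [hH2]) (by linarith [hH3])
  -- read the conclusion on the statement's events
  have e1 : {ω : BondConfig V | {e | e ∈ ω ∧ a ∉ e} ∉ openConn b c ∧
      {e | e ∈ ω ∧ b ∉ e} ∈ openConn a c ∧ {e | e ∈ ω ∧ c ∉ e} ∈ openConn a b} = Haᶜ ∩ Hb ∩ Hc := by
    ext ω; simp only [Set.mem_inter_iff, Set.mem_compl_iff, hHa, hHb, hHc, Set.mem_setOf_eq]; tauto
  have e2 : {ω : BondConfig V | {e | e ∈ ω ∧ a ∉ e} ∈ openConn b c ∧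
      {e | e ∈ ω ∧ b ∉ e} ∉ openConn a c ∧ {e | e ∈ ω ∧ c ∉ e} ∉ openConn a b} = Ha ∩ Hbᶜ ∩ Hcᶜ := by
    ext ω; simp only [Set.mem_inter_iff, Set.mem_compl_iff, hHa, hHb, hHc, Set.mem_setOf_eq]; tauto
  have e3 : {ω : BondConfig V | {e | e ∈ ω ∧ a ∉ e} ∈ openConn b c ∧
      {e | e ∈ ω ∧ b ∉ e} ∈ openConn a c ∧ {e | e ∈ ω ∧ c ∉ e} ∉ openConn a b} = Ha ∩ Hb ∩ Hcᶜ := by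
    ext ω; simp only [Set.mem_inter_iff, Set.mem_compl_iff, hHa, hHb, hHc, Set.mem_setOf_eq]; tauto
  have e4 : {ω : BondConfig V | {e | e ∈ ω ∧ a ∉ e} ∉ openConn b c ∧
      {e | e ∈ ω ∧ b ∉ e} ∈ openConn a c ∧ {e | e ∈ ω ∧ c ∉ e} ∉ openConn a b} = Haᶜ ∩ Hb ∩ Hcᶜ := by
    ext ω; simp only [Set.mem_inter_iff, Set.mem_compl_iff, hHa, hHb, hHc, Set.mem_setOf_eq]; tauto
  have e5 : {ω : BondConfig V | {e | e ∈ ω ∧ a ∉ e} ∈ openConn b c ∧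
      {e | e ∈ ω ∧ b ∉ e} ∈ openConn a c ∧ {e | e ∈ ω ∧ c ∉ e} ∈ openConn a b} = Ha ∩ Hb ∩ Hc := by
    ext ω; simp only [Set.mem_inter_iff, hHa, hHb, hHc, Set.mem_setOf_eq]; tauto
  have e6 : {ω : BondConfig V | {e | e ∈ ω ∧ a ∉ e} ∈ openConn b c ∧
      {e | e ∈ ω ∧ b ∉ e} ∉ openConn a c ∧ {e | e ∈ ω ∧ c ∉ e} ∈ openConn a b} = Ha ∩ Hbᶜ ∩ Hc := by
    ext ω; simp only [Set.mem_inter_iff, Set.mem_compl_iff, hHa, hHb, hHc, Set.mem_setOf_eq]; tauto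
  rw [e1, e2, e3, e4, e5, e6]
  exact key

/-- **dR2 for the random-cluster measure, every `q ≥ 1`**, in the atom form `u_a · T_a ≤ q · T₀`
(part III, `dualRowR2_PrW`, proved `u_a T_a + q (T_a + T_b + T_c) ≤ q t` for product measures, which
is the same inequality since `t = T_a + T_b + T_c + T₀`): for `φ = rcMeasureW w q ∅`,
`φ(H_a ¬H_b ¬H_c) · φ(¬H_a H_b H_c) ≤ φ(¬H_a ¬H_b ¬H_c) · φ(H_a H_b H_c)`.  PROOF (as in part III):
Harris/FKG for the decreasing `{a apart} = ¬H_b ¬H_c` and the increasing `H_a` gives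
`u_a ≤ (q + u_a) · P(H_a)`; with `Σ cells = 1` this is `u_a (u_b + u_c + T_a) ≤ q (T_b + T_c + T₀)`,
and the BHK rows at `b` and at `c` (`q T_b ≤ u_a u_c`, `q T_c ≤ u_a u_b`) finish.
[cite: VandenbergHaggstromKahn2005, Thm. 1.4 (p. 7); Grimmett2006, Thm. (3.8)] -/
theorem dualRowR2_rcMeasureW (w : Sym2 V → unitInterval) {q : ℝ} (hq : 1 ≤ q) {a b c : V}
    (hab : a ≠ b) (hac : a ≠ c) (hbc : b ≠ c) :
    (rcMeasureW w q ∅).real {ω : BondConfig V | {e | e ∈ ω ∧ a ∉ e} ∈ openConn b c ∧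
        {e | e ∈ ω ∧ b ∉ e} ∉ openConn a c ∧ {e | e ∈ ω ∧ c ∉ e} ∉ openConn a b} *
      (rcMeasureW w q ∅).real {ω : BondConfig V | {e | e ∈ ω ∧ a ∉ e} ∉ openConn b c ∧
        {e | e ∈ ω ∧ b ∉ e} ∈ openConn a c ∧ {e | e ∈ ω ∧ c ∉ e} ∈ openConn a b} ≤
    (rcMeasureW w q ∅).real {ω : BondConfig V | {e | e ∈ ω ∧ a ∉ e} ∉ openConn b c ∧
        {e | e ∈ ω ∧ b ∉ e} ∉ openConn a c ∧ {e | e ∈ ω ∧ c ∉ e} ∉ openConn a b} *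
      (rcMeasureW w q ∅).real {ω : BondConfig V | {e | e ∈ ω ∧ a ∉ e} ∈ openConn b c ∧
        {e | e ∈ ω ∧ b ∉ e} ∈ openConn a c ∧ {e | e ∈ ω ∧ c ∉ e} ∈ openConn a b} := by
  have hq0 : 0 < q := one_pos.trans_le hq
  haveI := isProbabilityMeasure_rcMeasureW w hq0 ∅
  obtain ⟨-, rowb, -, -, -, -, rowc, hmix⟩ := dualRow_inputs_rcMeasureW w hq hab hac hbc
  set μ := rcMeasureW w q ∅ with hμ
  set Ha : Set (BondConfig V) := {ω | {e | e ∈ ω ∧ a ∉ e} ∈ openConn b c} with hHa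
  set Hb : Set (BondConfig V) := {ω | {e | e ∈ ω ∧ b ∉ e} ∈ openConn a c} with hHb
  set Hc : Set (BondConfig V) := {ω | {e | e ∈ ω ∧ c ∉ e} ∈ openConn a b} with hHc
  -- additivity over the atoms
  have sA : μ.real Ha = μ.real (Ha ∩ Hb ∩ Hc) + μ.real (Ha ∩ Hb ∩ Hcᶜ) +
      (μ.real (Ha ∩ Hbᶜ ∩ Hc) + μ.real (Ha ∩ Hbᶜ ∩ Hcᶜ)) := by
    rw [KNGoodTwoMark.real_split μ Ha Hb, KNGoodTwoMark.real_split μ (Ha ∩ Hb) Hc,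
      KNGoodTwoMark.real_split μ (Ha ∩ Hbᶜ) Hc]
  have sAc : μ.real Haᶜ = μ.real (Haᶜ ∩ Hb ∩ Hc) + μ.real (Haᶜ ∩ Hb ∩ Hcᶜ) +
      (μ.real (Haᶜ ∩ Hbᶜ ∩ Hc) + μ.real (Haᶜ ∩ Hbᶜ ∩ Hcᶜ)) := by
    rw [KNGoodTwoMark.real_split μ Haᶜ Hb, KNGoodTwoMark.real_split μ (Haᶜ ∩ Hb) Hc,
      KNGoodTwoMark.real_split μ (Haᶜ ∩ Hbᶜ) Hc]
  have total : μ.real Ha + μ.real Haᶜ = 1 := by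
    rw [probReal_compl_eq_one_sub (MeasurableSet.of_discrete)]; ring
  have sBcCc : μ.real (Hbᶜ ∩ Hcᶜ) = μ.real (Ha ∩ Hbᶜ ∩ Hcᶜ) + μ.real (Haᶜ ∩ Hbᶜ ∩ Hcᶜ) := by
    rw [KNGoodTwoMark.real_split μ (Hbᶜ ∩ Hcᶜ) Ha]
    have e1 : Hbᶜ ∩ Hcᶜ ∩ Ha = Ha ∩ Hbᶜ ∩ Hcᶜ := by ext ω; simp only [Set.mem_inter_iff]; tauto
    have e2 : Hbᶜ ∩ Hcᶜ ∩ Haᶜ = Haᶜ ∩ Hbᶜ ∩ Hcᶜ := by ext ω; simp only [Set.mem_inter_iff]; tauto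
    rw [e1, e2]
  have eA : Ha ∩ (Hbᶜ ∩ Hcᶜ) = Ha ∩ Hbᶜ ∩ Hcᶜ := (Set.inter_assoc _ _ _).symm
  rw [eA, sBcCc] at hmix
  -- Harris with `Σ cells = 1`: `u_a · 1 ≤ P(H_a) · (u_a + q)`
  have h1 : μ.real (Ha ∩ Hbᶜ ∩ Hcᶜ) * (μ.real Ha + μ.real Haᶜ) ≤
      μ.real Ha * (μ.real (Ha ∩ Hbᶜ ∩ Hcᶜ) + μ.real (Haᶜ ∩ Hbᶜ ∩ Hcᶜ)) := by
    rw [total, mul_one]; exact hmix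
  rw [sA, sAc] at h1
  -- read the statement's events as atoms
  have e1 : {ω : BondConfig V | {e | e ∈ ω ∧ a ∉ e} ∈ openConn b c ∧
      {e | e ∈ ω ∧ b ∉ e} ∉ openConn a c ∧ {e | e ∈ ω ∧ c ∉ e} ∉ openConn a b} = Ha ∩ Hbᶜ ∩ Hcᶜ := by
    ext ω; simp only [Set.mem_inter_iff, Set.mem_compl_iff, hHa, hHb, hHc, Set.mem_setOf_eq]; tauto
  have e2 : {ω : BondConfig V | {e | e ∈ ω ∧ a ∉ e} ∉ openConn b c ∧
      {e | e ∈ ω ∧ b ∉ e} ∈ openConn a c ∧ {e | e ∈ ω ∧ c ∉ e} ∈ openConn a b} = Haᶜ ∩ Hb ∩ Hc := by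
    ext ω; simp only [Set.mem_inter_iff, Set.mem_compl_iff, hHa, hHb, hHc, Set.mem_setOf_eq]; tauto
  have e3 : {ω : BondConfig V | {e | e ∈ ω ∧ a ∉ e} ∉ openConn b c ∧
      {e | e ∈ ω ∧ b ∉ e} ∉ openConn a c ∧ {e | e ∈ ω ∧ c ∉ e} ∉ openConn a b} =
      Haᶜ ∩ Hbᶜ ∩ Hcᶜ := by
    ext ω; simp only [Set.mem_inter_iff, Set.mem_compl_iff, hHa, hHb, hHc, Set.mem_setOf_eq]; tauto
  have e4 : {ω : BondConfig V | {e | e ∈ ω ∧ a ∉ e} ∈ openConn b c ∧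
      {e | e ∈ ω ∧ b ∉ e} ∈ openConn a c ∧ {e | e ∈ ω ∧ c ∉ e} ∈ openConn a b} = Ha ∩ Hb ∩ Hc := by
    ext ω; simp only [Set.mem_inter_iff, hHa, hHb, hHc, Set.mem_setOf_eq]; tauto
  rw [e1, e2, e3, e4]
  nlinarith [h1, rowb, rowc, measureReal_nonneg (μ := μ) (s := Ha ∩ Hbᶜ ∩ Hcᶜ)]

end Rows

end PivotalBHK

end Summit.CriticalPhenomena.PercolationContinuityZ3.Theorems

end
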